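import Mathlib
import Literature.AlgebraicGeometry.Resolution.AbhyankarMonomialUniformization
import Summits.ResolutionOfSingularities.ResolutionOfSingularities.Theorems.RadicialJungCleanModelsKK05MonomialUniformization
import Summits.ResolutionOfSingularities.ResolutionOfSingularities.Theorems.AbhyankarShadowsSemivaluationShadowsQfgRankOne
import Literature.AlgebraicGeometry.Resolution.NormalizationFractions
import Summits.ResolutionOfSingularities.ResolutionOfSingularities.Theorems.RadicialJungCleanModelsAbhyankarKnafKuhlmann
import HarnessLib

/-!
# DISCHARGE of the named fact `KnafKuhlmann2005_Thm11_monomialForm` (Knaf–Kuhlmann 2005, Thm. 1.1 WITH its monomial clause) at universes `0, 0`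

Route `RadicialJung`, crux `CleanModels` (stmt-ResolutionOfSingularities-15917); explicit-unit seat `decomp-res-hand-1` g3 (hand 1, strategy «direct: discharge
printed inputs by name»).  The Literature named fact `Literature.AlgebraicGeometry.Resolution.KnafKuhlmann2005_Thm11_monomialForm`
(`AbhyankarMonomialUniformization.lean`, ✓ p793207; consumer ✓ p793208 `…AbhyankarKnafKuhlmann.lean`, which takes it at universes `.{0, 0}` as the PRINTED input
of the Abhyankar column of stub 7 `stub_cleanModelsDimGEFour` — every dimension — and of the dim-3 Abhyankar node over perfect ground fields) is here PROVED
at universes `.{0, 0}` from the tree: the ambient-form theorem ✓ `KK05ValueBasis.monomial_uniformization` (assembled from the PROVED Knaf–Kuhlmann chain: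
Generalized Stability Theorem, Thm. 3.4 with generating values, Perron's Lemma 4.2 / Thm. 4.1 with prescribed non-negative exponents, Lemma 5.1 with its
`B`-structure, Mathlib's unramified local criterion, affine dimension theory), read in the `k`/`K` vocabulary of the fact: `K₀ := k ⊆ K`, `F := K`,
`IsAbhyankarPlace` from `transcendenceDefect = 0` (✓ `isAbhyankarPlace_top_of_transcendenceDefect_eq_zero`), separable ALGEBRAIC residue field ⇒ separably
generated (empty basis) and zero-dimensional.

* `zeroDim_of_residue_integral`, `knafKuhlmann2005_Thm11_monomialForm_holds : KnafKuhlmann2005_Thm11_monomialForm.{0, 0}`,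
  `hAbh_dim_of_perfectField` (= hand-2 g2's `hAbh_dim_of_knafKuhlmann_of_perfectField`, ✓ p793208, now UNCONDITIONAL).

HONESTY: universes `0, 0` (the zero-dimensionality and Abhyankar-place bridges of the tree live at `Type`); this is the instance the consumers use.  Proves
EXACTLY the Literature def; nothing here proves resolution of singularities in characteristic `p`. [OURS · DISCHARGE of a printed input] counted 0.
-/

noncomputable section

set_option linter.dupNamespace false -- mandated namespace of this single-conjunct summit

open IsLocalRing
open Literature.AlgebraicGeometry.Resolution

namespace Summit.ResolutionOfSingularities.ResolutionOfSingularities.Theorems.RadicialJung.CleanModels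

namespace KK05ValueBasis

/-- **Zero-dimensionality from residues integral over `k`**: if the residue of `z ∈ 𝒪` is killed by a non-zero polynomial over `k` (for `k → 𝒪 → κ(𝒪)`),
then `z` satisfies a non-zero polynomial over `K₀ = k ⊆ K` modulo `𝔪_𝒪`. [folklore] -/
theorem zeroDim_of_residue_integral {k K : Type} [Field k] [Field K] [Algebra k K] (O : ValuationSubring K)
    (hk : ∀ c : k, algebraMap k K c ∈ O) {z : K} (hz : z ∈ O) (p : Polynomial k) (hp0 : p ≠ 0)
    (hp : Polynomial.eval₂ ((IsLocalRing.residue O).comp ((algebraMap k K).codRestrict O hk)) (IsLocalRing.residue O ⟨z, hz⟩) p = 0) :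
    ∃ P : Polynomial (algebraMap k K).fieldRange, P ≠ 0 ∧ Polynomial.aeval z P ∈ O.nonunits := by
  let ι : k →+* (algebraMap k K).fieldRange := (algebraMap k K).rangeRestrictField
  refine ⟨p.map ι, (Polynomial.map_ne_zero_iff ι.injective).mpr hp0, ?_⟩
  have h1 : Polynomial.aeval z (p.map ι) = Polynomial.eval₂ (algebraMap k K) z p := by
    rw [Polynomial.aeval_def, Polynomial.eval₂_map]; rfl
  let w : O := Polynomial.eval₂ ((algebraMap k K).codRestrict O hk) ⟨z, hz⟩ p
  have hw : (w : K) = Polynomial.eval₂ (algebraMap k K) z p := by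
    change O.subtype w = _
    rw [Polynomial.hom_eval₂]; rfl
  have hwm : w ∈ IsLocalRing.maximalIdeal O := by
    rw [← IsLocalRing.residue_eq_zero_iff, Polynomial.hom_eval₂]; exact hp
  rw [ValuationSubring.mem_nonunits_iff, h1, ← hw]
  exact (ValuationSubring.valuation_lt_one_iff O w).mp hwm

/-- **DISCHARGE of `KnafKuhlmann2005_Thm11_monomialForm` (Knaf–Kuhlmann 2005, Thm. 1.1 with the «Moreover» clause, residue-algebraic case) at universes
`0, 0`.** [cite: KnafKuhlmann2005, Thm. 1.1] -/
theorem knafKuhlmann2005_Thm11_monomialForm_holds :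
    Literature.AlgebraicGeometry.Resolution.KnafKuhlmann2005_Thm11_monomialForm.{0, 0} := by
  intro k K _ _ _ hKfg O hk hD hsep Z hZ
  classical
  set K₀ : Subfield K := (algebraMap k K).fieldRange with hK₀
  have hK₀O : (K₀ : Set K) ⊆ O := by rintro x ⟨c, rfl⟩; exact hk c
  have hfg : FGOver K₀ (⊤ : Subfield K) := by
    obtain ⟨s, hs⟩ := hKfg
    refine ⟨s, ?_⟩
    have h1 : (IntermediateField.adjoin k (s : Set K)).toSubfield =
        Subfield.closure (Set.range (algebraMap k K) ∪ (s : Set K)) := rfl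
    rw [RingHom.coe_fieldRange, ← h1, hs]
    rfl
  have hAbh : IsAbhyankarPlace O K₀ ⊤ := isAbhyankarPlace_top_of_transcendenceDefect_eq_zero hKfg O hk hD
  -- the `k`-structure of the residue field
  let φ : k →+* ResidueField O := (IsLocalRing.residue O).comp ((algebraMap k K).codRestrict O hk)
  letI algRes : Algebra k (ResidueField O) := φ.toAlgebra
  haveI hsepI : Algebra.IsSeparable k (ResidueField O) := hsep
  have hφmem : ∀ c : k, φ c ∈ resField O K₀ := fun c =>
    residue_mem_resField O ⟨algebraMap k K c, hk c⟩ ⟨c, rfl⟩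
  -- separably generated with the empty transcendence basis
  have hsep' : SeparablyGeneratedOver (resField O K₀) (resField O ⊤) := by
    refine ⟨∅, by simp, ?_, fun x _ => ?_⟩
    · haveI : FaithfulSMul (resField O K₀) (ResidueField O) :=
        (faithfulSMul_iff_algebraMap_injective _ _).mpr Subtype.val_injective
      exact algebraicIndependent_empty_type
    · set L := IntermediateField.adjoin (resField O K₀) ((∅ : Finset (ResidueField O)) : Set (ResidueField O)) with hL
      have hmemL : ∀ c : k, φ c ∈ L := fun c => L.algebraMap_mem ⟨φ c, hφmem c⟩
      letI : Algebra k L := (φ.codRestrict L hmemL).toAlgebra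
      haveI : IsScalarTower k L (ResidueField O) := IsScalarTower.of_algebraMap_eq fun c => rfl
      exact IsSeparable.tower_top L (Algebra.IsSeparable.isSeparable k x)
  -- zero-dimensional
  have hzd : ∀ z : K, z ∈ O → ∃ P : Polynomial K₀, P ≠ 0 ∧ Polynomial.aeval z P ∈ O.nonunits := by
    intro z hz
    obtain ⟨p, hpm, hp⟩ := (Algebra.IsSeparable.isSeparable k (IsLocalRing.residue O ⟨z, hz⟩)).isIntegral
    exact zeroDim_of_residue_integral O hk hz p hpm.ne_zero hp
  -- the ambient-form theorem with `F = K`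
  obtain ⟨A, hAV, -, hAfg, hfrac, hZA, hreg, ρ, a, hspan, hdim, hmono⟩ :=
    monomial_uniformization O K₀ ⊤ hfg hK₀O hAbh hsep' hzd Z (fun z hz => ⟨hZ z hz, trivial⟩)
  -- the same subring as a `k`-subalgebra
  let A' : Subalgebra k K :=
    { A.toSubring.toSubsemiring with
      algebraMap_mem' := fun c => A.algebraMap_mem (⟨algebraMap k K c, c, rfl⟩ : K₀) }
  refine ⟨A', ?_, hAV, ?_, fun z hz => hZA z hz, hreg, ρ, a, hspan.symm, hdim, fun z hz hz0 => hmono z hz hz0⟩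
  · -- `A'` is finitely generated over `k` (by the `K₀`-generators of `A`)
    obtain ⟨t₂, ht₂⟩ := hAfg
    refine ⟨t₂, le_antisymm (Algebra.adjoin_le fun x hx => ?_) fun x hx => ?_⟩
    · change x ∈ A
      rw [← ht₂]
      exact Algebra.subset_adjoin hx
    · let T : Subalgebra K₀ K :=
        { (Algebra.adjoin k (t₂ : Set K)).toSubring.toSubsemiring with
          algebraMap_mem' := fun c => by
            obtain ⟨c', hc'⟩ := c.2
            change (c : K) ∈ Algebra.adjoin k (t₂ : Set K)
            rw [← hc']
            exact (Algebra.adjoin k (t₂ : Set K)).algebraMap_mem c' }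
      have hAT : A ≤ T := by
        rw [← ht₂]
        exact Algebra.adjoin_le fun y hy => (Algebra.subset_adjoin hy : y ∈ Algebra.adjoin k _)
      exact hAT hx
  · -- `Frac A' = K`
    exact isFractionRing_of_forall_exists_div A'.toSubring fun z => by
      obtain ⟨a, ha, b, hb, hab⟩ := hfrac z trivial
      exact ⟨a, ha, b, hb, hab⟩

/-- **The Abhyankar column of stub 7 (every dimension) and of the dim-3 node, over PERFECT ground fields, is now KERNEL-CLOSED**: hand-2 g2's
`hAbh_dim_of_knafKuhlmann_of_perfectField` (✓ p793208) with its printed input `KnafKuhlmann2005_Thm11_monomialForm` DISCHARGED by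
`knafKuhlmann2005_Thm11_monomialForm_holds`. [cite: KnafKuhlmann2005, Thm. 1.1] [cite: Kuhlmann2010, Thm. 1.1] -/
theorem hAbh_dim_of_perfectField (d : ℕ) :
    ∀ (p : ℕ), p.Prime →
    ∀ (k : Type) [Field k] [CharP k p] [PerfectField k] (K : Type) [Field K] [Algebra k K]
    (O : ValuationSubring K) (A : Subalgebra k K), A.toSubring ≤ O.toSubring → A.FG → IsFractionRing A K →
    ringKrullDim A ≤ (d : WithBot ℕ∞) → IsRegularLocalRing (locAtCentre A.toSubring O) →
    ringKrullDim (locAtCentre A.toSubring O) = (d : WithBot ℕ∞) →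
    (∀ (T : Subring K) (hT : T ≤ O.toSubring), A.toSubring ≤ T → (subringCentre T O hT).IsMaximal) →
    ∀ g₀ : K, (∀ c : K, c ^ p ≠ g₀) →
    ∀ hk : ∀ c : k, algebraMap k K c ∈ O, transcendenceDefect k O hk = 0 →
    ∃ (A' : Subalgebra k K), A'.toSubring ≤ O.toSubring ∧ A ≤ A' ∧ A'.FG ∧
    ∃ (_ : IsRegularLocalRing (locAtCentre A'.toSubring O)) (c : Fin p → K), (∃ j : Fin p, (j : ℕ) ≠ 0 ∧ c j ≠ 0) ∧
    ((∃ (d m : ℕ) (hmd : m ≤ d) (t : Fin d → ↥(locAtCentre A'.toSubring O)) (a : Fin m → ℕ) (u : ↥(locAtCentre A'.toSubring O)), IsUnit u ∧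
    Ideal.span (Set.range t) = IsLocalRing.maximalIdeal ↥(locAtCentre A'.toSubring O) ∧
    ringKrullDim ↥(locAtCentre A'.toSubring O) = (d : WithBot ℕ∞) ∧ 0 < m ∧ (∀ i, ¬ p ∣ a i) ∧
    (∑ j : Fin p, c j ^ p * g₀ ^ (j : ℕ)) = (u : K) * ∏ i : Fin m, ((t (Fin.castLE hmd i) : ↥(locAtCentre A'.toSubring O)) : K) ^ (a i)) ∨
    (∃ u : ↥(locAtCentre A'.toSubring O), IsUnit u ∧ (∑ j : Fin p, c j ^ p * g₀ ^ (j : ℕ)) = (u : K) ∧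
    ∀ c' : ↥(locAtCentre A'.toSubring O), u - c' ^ p ∉ IsLocalRing.maximalIdeal ↥(locAtCentre A'.toSubring O)) ∨
    (∃ s c' : ↥(locAtCentre A'.toSubring O), (∑ j : Fin p, c j ^ p * g₀ ^ (j : ℕ)) = (s : K) ∧
    s - c' ^ p ∈ IsLocalRing.maximalIdeal ↥(locAtCentre A'.toSubring O) ∧
    s - c' ^ p ∉ IsLocalRing.maximalIdeal ↥(locAtCentre A'.toSubring O) ^ 2)) :=
  hAbh_dim_of_knafKuhlmann_of_perfectField knafKuhlmann2005_Thm11_monomialForm_holds d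

/-- **The Abhyankar class of clean local uniformization (any dimension, residue field separable over `k`) — UNCONDITIONAL**: hand-2 g2's
`cleanLUAbh_of_knafKuhlmann` (✓ p793208) with its printed input discharged by `knafKuhlmann2005_Thm11_monomialForm_holds`.
[cite: KnafKuhlmann2005, Thm. 1.1] [cite: Kuhlmann2010, Thm. 1.1] -/
theorem cleanLUAbh_holds
    (p : ℕ) (hp : p.Prime) (k : Type) [Field k] [CharP k p] (K : Type) [Field K] [Algebra k K]
    (O : ValuationSubring K) (A : Subalgebra k K) (hAO : A.toSubring ≤ O.toSubring) (hAfg : A.FG)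
    (hfrac : IsFractionRing A K)
    (g₀ : K) (hg₀ : ∀ c : K, c ^ p ≠ g₀)
    (hk : ∀ c : k, algebraMap k K c ∈ O) (htd : transcendenceDefect k O hk = 0)
    (hsep : @Algebra.IsSeparable k (ResidueField O) _ _
      ((IsLocalRing.residue O).comp ((algebraMap k K).codRestrict O hk)).toAlgebra) :
    ∃ (A' : Subalgebra k K), A'.toSubring ≤ O.toSubring ∧ A ≤ A' ∧ A'.FG ∧
      ∃ (_ : IsRegularLocalRing (locAtCentre A'.toSubring O)) (c : Fin p → K),
        (∃ j : Fin p, (j : ℕ) ≠ 0 ∧ c j ≠ 0) ∧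
        ((∃ (d m : ℕ) (hmd : m ≤ d) (t : Fin d → ↥(locAtCentre A'.toSubring O)) (a : Fin m → ℕ)
            (u : ↥(locAtCentre A'.toSubring O)), IsUnit u ∧
            Ideal.span (Set.range t) = IsLocalRing.maximalIdeal ↥(locAtCentre A'.toSubring O) ∧
            ringKrullDim ↥(locAtCentre A'.toSubring O) = (d : WithBot ℕ∞) ∧ 0 < m ∧ (∀ i, ¬ p ∣ a i) ∧
            (∑ j : Fin p, c j ^ p * g₀ ^ (j : ℕ)) =
              (u : K) * ∏ i : Fin m, ((t (Fin.castLE hmd i) : ↥(locAtCentre A'.toSubring O)) : K) ^ (a i)) ∨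
          (∃ u : ↥(locAtCentre A'.toSubring O), IsUnit u ∧ (∑ j : Fin p, c j ^ p * g₀ ^ (j : ℕ)) = (u : K) ∧
            ∀ c' : ↥(locAtCentre A'.toSubring O), u - c' ^ p ∉ IsLocalRing.maximalIdeal ↥(locAtCentre A'.toSubring O)) ∨
          (∃ s c' : ↥(locAtCentre A'.toSubring O), (∑ j : Fin p, c j ^ p * g₀ ^ (j : ℕ)) = (s : K) ∧
            s - c' ^ p ∈ IsLocalRing.maximalIdeal ↥(locAtCentre A'.toSubring O) ∧
            s - c' ^ p ∉ IsLocalRing.maximalIdeal ↥(locAtCentre A'.toSubring O) ^ 2)) :=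
  cleanLUAbh_of_knafKuhlmann knafKuhlmann2005_Thm11_monomialForm_holds p hp k K O A hAO hAfg hfrac g₀ hg₀ hk htd hsep

/-- **The Abhyankar class over a PERFECT ground field (any dimension; in particular the dim-3 Abhyankar node of the `CleanModels` skeleton) —
UNCONDITIONAL**: hand-2 g2's `cleanLUAbh_of_knafKuhlmann_of_perfectField` (✓ p793208) with its printed input discharged by
`knafKuhlmann2005_Thm11_monomialForm_holds`. [cite: KnafKuhlmann2005, Thm. 1.1] [cite: Kuhlmann2010, Thm. 1.1] -/
theorem cleanLUAbh_of_perfectField_holds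
    (p : ℕ) (hp : p.Prime) (k : Type) [Field k] [CharP k p] [PerfectField k] (K : Type) [Field K] [Algebra k K]
    (O : ValuationSubring K) (A : Subalgebra k K) (hAO : A.toSubring ≤ O.toSubring) (hAfg : A.FG)
    (hfrac : IsFractionRing A K)
    (hzd : ∀ (T : Subring K) (hT : T ≤ O.toSubring), A.toSubring ≤ T → (subringCentre T O hT).IsMaximal)
    (g₀ : K) (hg₀ : ∀ c : K, c ^ p ≠ g₀)
    (hk : ∀ c : k, algebraMap k K c ∈ O) (htd : transcendenceDefect k O hk = 0) :
    ∃ (A' : Subalgebra k K), A'.toSubring ≤ O.toSubring ∧ A ≤ A' ∧ A'.FG ∧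
      ∃ (_ : IsRegularLocalRing (locAtCentre A'.toSubring O)) (c : Fin p → K),
        (∃ j : Fin p, (j : ℕ) ≠ 0 ∧ c j ≠ 0) ∧
        ((∃ (d m : ℕ) (hmd : m ≤ d) (t : Fin d → ↥(locAtCentre A'.toSubring O)) (a : Fin m → ℕ)
            (u : ↥(locAtCentre A'.toSubring O)), IsUnit u ∧
            Ideal.span (Set.range t) = IsLocalRing.maximalIdeal ↥(locAtCentre A'.toSubring O) ∧
            ringKrullDim ↥(locAtCentre A'.toSubring O) = (d : WithBot ℕ∞) ∧ 0 < m ∧ (∀ i, ¬ p ∣ a i) ∧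
            (∑ j : Fin p, c j ^ p * g₀ ^ (j : ℕ)) =
              (u : K) * ∏ i : Fin m, ((t (Fin.castLE hmd i) : ↥(locAtCentre A'.toSubring O)) : K) ^ (a i)) ∨
          (∃ u : ↥(locAtCentre A'.toSubring O), IsUnit u ∧ (∑ j : Fin p, c j ^ p * g₀ ^ (j : ℕ)) = (u : K) ∧
            ∀ c' : ↥(locAtCentre A'.toSubring O), u - c' ^ p ∉ IsLocalRing.maximalIdeal ↥(locAtCentre A'.toSubring O)) ∨
          (∃ s c' : ↥(locAtCentre A'.toSubring O), (∑ j : Fin p, c j ^ p * g₀ ^ (j : ℕ)) = (s : K) ∧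
            s - c' ^ p ∈ IsLocalRing.maximalIdeal ↥(locAtCentre A'.toSubring O) ∧
            s - c' ^ p ∉ IsLocalRing.maximalIdeal ↥(locAtCentre A'.toSubring O) ^ 2)) :=
  cleanLUAbh_of_knafKuhlmann_of_perfectField knafKuhlmann2005_Thm11_monomialForm_holds p hp k K O A hAO hAfg hfrac hzd g₀ hg₀ hk htd

end KK05ValueBasis

end Summit.ResolutionOfSingularities.ResolutionOfSingularities.Theorems.RadicialJung.CleanModels

end
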